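import Summits.HodgeConjecture.CorCM.OcticWeilOrbitFamilyHodgeOfMarkman
import Summits.HodgeConjecture.CorCM.OcticWeilFourfoldMumfordExample
import HarnessLib

/-!
# COR-CM — the Galois orbit of a simple CM fourfold of Weil type: NON-VACUITY (Mumford's fourfold, two further
# `(2,2)`-types of `F(i)` in general position, and the CM curve of `ℚ(i)` inhabit every hypothesis)

Cell `pub-hodgecm2` (COR-CM), seat b30 gen 20 (2026-08-22); count-neutral own lane OCTIC-WEIL-ORBIT.  Theorems only; no
definition, no named fact of its own, no `sorry`.

`exists_hypotheses_octicWeilOrbit`: the hypotheses of the geometric theorem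
`OcticWeilOrbit.hodgeConjectureFor_biproduct_comp_vec_of_isSimple_of_markman₃` (`CorCM/OcticWeilOrbitHodgeOfMarkman.lean`) are
INHABITED — an octic CM field `K` (Mumford–Pohlmann's `F(i)`, tree `Pohlmann1968/MumfordSimpleFourfold`), `k = ℚ(i)` with
`i : k → K`, `τ`, three CM types `Φ₁, Φ₂, Φ₃` of `k`-signature `(2,2)` in general position — `Φ₁ = Φ_P` Mumford's Weil type
(`|P| = 2`) with a SIMPLE realisation `B₁` (`isSimple_and_exists_exceptional`), `Φ₂, Φ₃` the two other types of the star
through a frame of `Φ₁` — realised by the tree's UNCONDITIONAL `cmAbelianVarietyRealised_holds` (Shimura §6.2 Thm. 3), and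
a CM elliptic curve `E ⊨ (ℚ(i); {τ})`.  Consequently (`hodgeConjectureFor_mumfordOrbit_of_markman`) Markman's fourfold
theorem yields the Hodge conjecture for every product of copies of these four varieties — a non-empty family of
statements — and (`hodgeConjectureFor_mumfordFamily_of_markman`, via the family form
`CorCM/OcticWeilOrbitFamilyHodgeOfMarkman.lean`) for EVERY finite product of realisations of Mumford's Weil types `Φ_P`,
`|P| = 2` (all six of them, any multiplicities) and any power of a CM curve of `ℚ(i)`.
HONEST FRAMING: conditional on `Markman2025_weilClasses_algebraic_abelianFourfold`; `HC_CM` is not asserted.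

## References
* [Pohlmann1968] H. Pohlmann, Ann. of Math. 88 (1968), §3 (Mumford's example).  [vanGeemen1994HodgeAV] B. van Geemen,
  Thm. 4.5, 4.7.  [Shimura1998] G. Shimura, §6.2 Thm. 3, §8.2 Prop. 26.  [Dodson1984] B. Dodson, Trans. AMS 283, §3.3.2.
  [Markman2025SurveySecant] E. Markman, arXiv:2509.23403, Thm. 1.2.
-/

noncomputable section

open CategoryTheory CategoryTheory.Limits NumberField

namespace Summit.HodgeConjecture.CorCM.OcticWeilOrbit.MumfordExample

open Literature.AlgebraicGeometry Literature.AlgebraicGeometry.Motives Literature.AlgebraicGeometry.HodgeTheory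
open Literature.AlgebraicGeometry.ComplexMultiplication (IsCMTypeRealisation)
open Literature.AlgebraicTopology.SingularHomology
open Literature.AlgebraicGeometry.Pohlmann1968.MumfordFourfold (K Qi j weilType finrank_K isSimple_and_exists_exceptional)
open Literature.NumberTheory.NumberFields.MumfordQuartic (F)
open Literature.NumberTheory.ComplexMultiplication (CMTypeCount.single CMTypeCount.single_val)
open Summit.HodgeConjecture.CorCM.Census.OcticWeilOrbit (signTab)
open Summit.HodgeConjecture.CorCM.OcticWeilFourfold (exists_frame₂)
open Summit.HodgeConjecture.CorCM.OcticWeilFourfold.MumfordExample (finrank_Qi isCMField_Qi card_filter_comp_j_eq_two)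

open scoped Classical

/-! ## The hypotheses of OCTIC-WEIL-ORBIT are inhabited; Mumford's orbit -/

/-- **NON-VACUITY.**  There exist an octic CM field `K`, an imaginary quadratic CM field `k`, `i : k → K`, `τ : k → ℂ`, three
CM types `Φ₁, Φ₂, Φ₃` of `K` with realisations `B₁, B₂, B₃`, `B₁` SIMPLE, and a CM elliptic curve `E ⊨ (k; Ψ ∋ τ)` satisfying
every counting hypothesis of `hodgeConjectureFor_biproduct_comp_vec_of_isSimple_of_markman₃` — `k`-signature `(2,2)` for each
type, general position pairwise.  Witness: Mumford's `K = F(i) ⊃ ℚ(i)`, `Φ₁ = Φ_P` (`|P| = 2`, primitive ⇒ `B₁` simple), and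
the two further types of the star through a frame of `Φ₁`; all realised by the tree's `cmAbelianVarietyRealised_holds`.
[cite: Pohlmann1968, §3] [cite: vanGeemen1994HodgeAV, Thm. 4.5] [cite: Shimura1998, §6.2 Thm. 3] -/
theorem exists_hypotheses_octicWeilOrbit :
    ∃ (K k : Type) (_ : Field K) (_ : NumberField K) (_ : IsCMField K) (_ : Field k) (_ : NumberField k) (_ : IsCMField k)
      (i : k →+* K) (τ : k →+* ℂ) (Φ₁ Φ₂ Φ₃ : CMType K) (B₁ B₂ B₃ : AbelianVariety ℂ)
      (ι₁ : 𝓞 K →+* End B₁) (θ₁ : K →+* Module.End ℂ (complexBetti B₁.X 1))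
      (ι₂ : 𝓞 K →+* End B₂) (θ₂ : K →+* Module.End ℂ (complexBetti B₂.X 1))
      (ι₃ : 𝓞 K →+* End B₃) (θ₃ : K →+* Module.End ℂ (complexBetti B₃.X 1))
      (Ψ : CMType k) (E : AbelianVariety ℂ) (ιE : 𝓞 k →+* End E) (θE : k →+* Module.End ℂ (complexBetti E.X 1)),
      Module.finrank ℚ K = 8 ∧ Module.finrank ℚ k = 2 ∧
      IsCMTypeRealisation Φ₁ B₁ ι₁ θ₁ ∧ B₁.IsSimple ∧ IsCMTypeRealisation Φ₂ B₂ ι₂ θ₂ ∧ IsCMTypeRealisation Φ₃ B₃ ι₃ θ₃ ∧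
      IsCMTypeRealisation Ψ E ιE θE ∧ τ ∈ Ψ.1 ∧
      (Finset.univ.filter fun s : K →+* ℂ => s.comp i = τ ∧ s ∈ Φ₁.1).card = 2 ∧
      (Finset.univ.filter fun s : K →+* ℂ => s.comp i = τ ∧ s ∈ Φ₂.1).card = 2 ∧
      (Finset.univ.filter fun s : K →+* ℂ => s.comp i = τ ∧ s ∈ Φ₃.1).card = 2 ∧
      (Finset.univ.filter fun s : K →+* ℂ => s.comp i = τ ∧ (s ∈ Φ₁.1 ∧ s ∈ Φ₂.1)).card = 1 ∧
      (Finset.univ.filter fun s : K →+* ℂ => s.comp i = τ ∧ (s ∈ Φ₁.1 ∧ s ∈ Φ₃.1)).card = 1 ∧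
      (Finset.univ.filter fun s : K →+* ℂ => s.comp i = τ ∧ (s ∈ Φ₂.1 ∧ s ∈ Φ₃.1)).card = 1 := by
  haveI : IsCMField Qi := isCMField_Qi
  -- a `2`-set of real embeddings of `F`, Mumford's type `Φ_P`, a simple realisation
  obtain ⟨P, -, hP⟩ := Finset.exists_subset_card_eq (s := (Finset.univ : Finset (F →+* ℂ))) (n := 2)
    (by rw [Finset.card_univ, Literature.NumberTheory.NumberFields.MumfordQuartic.card_embeddings]; norm_num)
  obtain ⟨B₁, ι₁, θ₁, hB₁⟩ := cmAbelianVarietyRealised_holds K (weilType P)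
  -- an embedding `τ` of `ℚ(i)` and the CM curve
  obtain ⟨τ⟩ : Nonempty (Qi →+* ℂ) := inferInstance
  obtain ⟨E, ιE, θE, hE⟩ := cmAbelianVarietyRealised_holds Qi (CMTypeCount.single finrank_Qi τ)
  have hττ : ComplexEmbedding.conjugate τ ≠ τ := QuarticCM.conjugate_ne τ
  have hk : ∀ σ : Qi →+* ℂ, σ = τ ∨ σ = ComplexEmbedding.conjugate τ := fun σ =>
    QuarticCM.eq_or_eq_conjugate_of_quadratic finrank_Qi τ σ
  -- a frame of `Φ_P` over `(j, τ)`; `Φ_P` reads as `I_0`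
  obtain ⟨e, he_sign, he_conj, hΦP⟩ := exists_frame₂ finrank_K finrank_Qi j hττ hk (weilType P)
    (card_filter_comp_j_eq_two hP τ)
  have hr₁ : ∀ s, s ∈ (weilType P).1 ↔ (e s).2 = signTab 0 0 (e s).1 := fun s => by
    rw [hΦP s, inr_mem_phi₂_iff_signTab]
  -- the other two types of the star and their realisations
  obtain ⟨Φ₂, hr₂⟩ := exists_cmType_of_frame he_conj 1
  obtain ⟨Φ₃, hr₃⟩ := exists_cmType_of_frame he_conj 2
  obtain ⟨B₂, ι₂, θ₂, hB₂⟩ := cmAbelianVarietyRealised_holds K Φ₂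
  obtain ⟨B₃, ι₃, θ₃, hB₃⟩ := cmAbelianVarietyRealised_holds K Φ₃
  -- the counts
  obtain ⟨h22₁, h₁₂⟩ := counts_of_frame he_sign (show (0 : Fin 3) ≠ 1 by decide) hr₁ hr₂
  obtain ⟨h22₂, h₂₃⟩ := counts_of_frame he_sign (show (1 : Fin 3) ≠ 2 by decide) hr₂ hr₃
  obtain ⟨h22₃, -⟩ := counts_of_frame he_sign (show (2 : Fin 3) ≠ 0 by decide) hr₃ hr₁
  obtain ⟨-, h₁₃⟩ := counts_of_frame he_sign (show (0 : Fin 3) ≠ 2 by decide) hr₁ hr₃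
  exact ⟨K, Qi, inferInstance, inferInstance, inferInstance, inferInstance, inferInstance, inferInstance, j, τ, weilType P,
    Φ₂, Φ₃, B₁, B₂, B₃, ι₁, θ₁, ι₂, θ₂, ι₃, θ₃, CMTypeCount.single finrank_Qi τ, E, ιE, θE, finrank_K, finrank_Qi, hB₁,
    (isSimple_and_exists_exceptional hP hB₁).1, hB₂, hB₃, hE, by rw [CMTypeCount.single_val]; rfl, h22₁, h22₂, h22₃, h₁₂,
    h₁₃, h₂₃⟩

/-- **MUMFORD'S ORBIT: the Hodge conjecture for every product of copies of `E, B₁, B₂, B₃`, GIVEN ONLY Markman's fourfold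
theorem**, where `B₁ ⊨ (F(i); Φ_P)` is any realisation of Mumford's Weil type (`|P| = 2`; simple), `B₂, B₃` realise the two
further `(2,2)`-types of the star through a frame `e` of `Φ_P` over `(j, τ)` (`s ∈ Φ_{m+1} ⟺ (e s).2 = [(e s).1 ∈ {0, m+1}]`;
such types exist for every frame, `exists_cmType_of_frame`), and `E` is a CM elliptic curve of `ℚ(i)`. [cite: Markman2025SurveySecant, Thm. 1.2] [cite: Pohlmann1968, §3] [cite: vanGeemen1994HodgeAV, Thm. 4.5] -/
theorem hodgeConjectureFor_mumfordOrbit_of_markman (hW4 : Markman2025_weilClasses_algebraic_abelianFourfold)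
    {N : ℕ} {P : Finset (F →+* ℂ)} (hP : P.card = 2) {τ : Qi →+* ℂ} {e : (K →+* ℂ) ≃ Fin 4 × Bool}
    (he_sign : ∀ s, (e s).2 = true ↔ s.comp j = τ)
    {Φ₂ Φ₃ : CMType K} (hr₁ : ∀ s, s ∈ (weilType P).1 ↔ (e s).2 = signTab 0 0 (e s).1)
    (hr₂ : ∀ s, s ∈ Φ₂.1 ↔ (e s).2 = signTab 0 1 (e s).1) (hr₃ : ∀ s, s ∈ Φ₃.1 ↔ (e s).2 = signTab 0 2 (e s).1)
    {B₁ B₂ B₃ : AbelianVariety ℂ} {ι₁ : 𝓞 K →+* End B₁} {θ₁ : K →+* Module.End ℂ (complexBetti B₁.X 1)}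
    {ι₂ : 𝓞 K →+* End B₂} {θ₂ : K →+* Module.End ℂ (complexBetti B₂.X 1)}
    {ι₃ : 𝓞 K →+* End B₃} {θ₃ : K →+* Module.End ℂ (complexBetti B₃.X 1)}
    (hB₁ : IsCMTypeRealisation (weilType P) B₁ ι₁ θ₁) (hB₂ : IsCMTypeRealisation Φ₂ B₂ ι₂ θ₂)
    (hB₃ : IsCMTypeRealisation Φ₃ B₃ ι₃ θ₃)
    {Ψ : CMType Qi} {E : AbelianVariety ℂ} {ιE : 𝓞 Qi →+* End E} {θE : Qi →+* Module.End ℂ (complexBetti E.X 1)}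
    (hE : IsCMTypeRealisation Ψ E ιE θE) (hτΨ : τ ∈ Ψ.1) (κ : Fin N → Fin 4) :
    HodgeConjectureFor (⨁ fun m => (![E, B₁, B₂, B₃] : Fin 4 → AbelianVariety ℂ) (κ m)).dim
      (⨁ fun m => (![E, B₁, B₂, B₃] : Fin 4 → AbelianVariety ℂ) (κ m)).X := by
  haveI : IsCMField Qi := isCMField_Qi
  obtain ⟨h22₁, h₁₂⟩ := counts_of_frame he_sign (show (0 : Fin 3) ≠ 1 by decide) hr₁ hr₂
  obtain ⟨h22₂, h₂₃⟩ := counts_of_frame he_sign (show (1 : Fin 3) ≠ 2 by decide) hr₂ hr₃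
  obtain ⟨h22₃, -⟩ := counts_of_frame he_sign (show (2 : Fin 3) ≠ 0 by decide) hr₃ hr₁
  obtain ⟨-, h₁₃⟩ := counts_of_frame he_sign (show (0 : Fin 3) ≠ 2 by decide) hr₁ hr₃
  exact hodgeConjectureFor_biproduct_comp_vec_of_isSimple_of_markman₃ hW4 finrank_K finrank_Qi j hB₁
    (isSimple_and_exists_exceptional hP hB₁).1 hB₂ hB₃ hE hτΨ h22₁ h22₂ h22₃ h₁₂ h₁₃ h₂₃ κ

/-- **MUMFORD'S SIX WEIL TYPES, family form**: for ANY finite family `A_j ⊨ (F(i); Φ_{P_j})` of realisations of Mumford's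
Weil types (`|P_j| = 2`; all simple) and any CM elliptic curve `E ⊨ (ℚ(i); Ψ)`: the Hodge conjecture for `E^a × ∏_j A_j` and
everything it dominates, GIVEN ONLY Markman's fourfold theorem (`OcticWeilOrbit.hodgeConjectureFor_of_avDominatedBy_family…`).
[cite: Markman2025SurveySecant, Thm. 1.2] [cite: Pohlmann1968, §3] [cite: vanGeemen1994HodgeAV, Thm. 4.5 and 4.7] -/
theorem hodgeConjectureFor_mumfordFamily_of_markman (hW4 : Markman2025_weilClasses_algebraic_abelianFourfold)
    {n : ℕ} [NeZero n] {P : Fin n → Finset (F →+* ℂ)} (hP : ∀ j, (P j).card = 2) {A : Fin n → AbelianVariety ℂ}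
    {ι : ∀ j, 𝓞 K →+* End (A j)} {θ : ∀ j, K →+* Module.End ℂ (complexBetti (A j).X 1)}
    (hA : ∀ j, IsCMTypeRealisation (weilType (P j)) (A j) (ι j) (θ j))
    {Ψ : CMType Qi} {E : AbelianVariety ℂ} {ιE : 𝓞 Qi →+* End E} {θE : Qi →+* Module.End ℂ (complexBetti E.X 1)}
    (hE : IsCMTypeRealisation Ψ E ιE θE) (a : ℕ) {C : AbelianVariety ℂ}
    (hC : Domination.AVDominatedBy C ((⨁ fun _ : Fin a => E).prod (⨁ A))) : HodgeConjectureFor C.dim C.X := by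
  haveI : IsCMField Qi := isCMField_Qi
  obtain ⟨a₀⟩ : Nonempty (Qi →+* ℂ) := inferInstance
  obtain ⟨τ, hτΨ⟩ : ∃ τ, τ ∈ Ψ.1 := by
    by_cases h : a₀ ∈ Ψ.1
    · exact ⟨a₀, h⟩
    · exact ⟨ComplexEmbedding.conjugate a₀, (Ψ.2 _).2 (by rw [ComplexEmbedding.involutive_conjugate Qi a₀]; exact h)⟩
  exact hodgeConjectureFor_of_avDominatedBy_family_of_isSimple_of_markman (Φ := fun j => weilType (P j)) hW4 finrank_K
    finrank_Qi j hA (fun j' => card_filter_comp_j_eq_two (hP j') τ) (j₀ := 0)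
    (isSimple_and_exists_exceptional (hP 0) (hA 0)).1 hE hτΨ a hC

end Summit.HodgeConjecture.CorCM.OcticWeilOrbit.MumfordExample

end
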